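import Literature.Probability.LatticeModels.CableGFFLevelSets
import Literature.Probability.LatticeModels.ProdBernoulliClusterLocality
import HarnessLib

/-!
# The two-sided Lupu weights and the quenched percolation probabilities as random variables

Topic `Literature/Probability/LatticeModels`; proofs-only companion of `CableGFFLevelSets.lean`
(`lupuWeight ψ`: conditionally on the discrete field `ψ = φ + h`, the cable `{u, v}` of `ℤ̃^d` stays
in `{φ̃ > -h}` with probability `1 - exp(-2 ψ_u⁺ ψ_v⁺)`). The TWO-SIDED weight
`lupuWeight ψ ⊔ lupuWeight (-ψ)` of an edge is `1 - exp(-2 (ψ_u ψ_v)⁺)`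
(`coe_sup_lupuWeight_of_adj`), the conditional probability that the cable carries NO zero of
`φ̃ + h`, i.e. lies inside one sign cluster of `φ̃ + h` (Lupu 2016, Cor. 3.6, (4.2):
`1_{ψ_xψ_y > 0}(1 - e^{-2C(x,y)|ψ_xψ_y|})`); the bond model with these weights is the vertex trace
of the sign clusters of `φ̃ + h`, of which the one-sided model keeps the positive ones.

## Contents (all proved)

* algebra of the two-sided weights: `coe_sup_lupuWeight_of_adj`, `sup_lupuWeight_of_not_mem`,
  `sup_lupuWeight_neg` (invariance under `ψ ↦ -ψ`), `sup_lupuWeight_congr` (dependence through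
  `ψ_u ψ_v` only), `sup_lupuWeight_flip_eq` (flipping `ψ` on `K` does not change the weights inside
  `K`), `sup_lupuWeight_eq_of_pos`, `lupuWeight_eq_zero_of_pos_of_nonpos`,
  `sup_lupuWeight_eq_zero_of_pos_of_nonpos` (one- and two-sided weights agree on every edge with a
  positive endpoint; edges from positive to non-positive sites are closed in both);
* measurability: `measurable_lupuWeight`, `measurable_sup_lupuWeight`,
  `measurable_prodBernoulli_lupuWeight_real` (the quenched probabilities `ψ ↦ P^ψ(A)` are measurable
  functions of the field, via `measurable_prodBernoulli_apply`);
* **Step A** of the proof of `Lupu2016_cableLevelSetsPercolate`: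
  `prodBernoulli_sup_lupuWeight_real_percolatesAt_eq_of_pos` (from a positive site the one- and
  two-sided percolation probabilities agree — cluster locality,
  `prodBernoulli_real_percolatesAt_eq_of_eqOn`),
  `prodBernoulli_lupuWeight_real_percolatesAt_eq_zero_of_nonpos`, and the pointwise inequality
  `mul_real_percolatesAt_sup_le : ψ_x θ²(ψ) ≤ ψ_x⁺ θ¹(ψ)`.

Reference: T. Lupu, Ann. Probab. 44 (2016), arXiv:1402.0298, Cor. 3.6 and §4 (bib key `Lupu2016`).
-/

noncomputable section

namespace Literature.Probability.LatticeModels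

open _root_.MeasureTheory _root_.ProbabilityTheory Literature.Probability.Percolation Finset

variable {d : ℕ}

/-! ### The two-sided Lupu weights `lupuWeight ψ ⊔ lupuWeight (-ψ)` -/

/-- `max(a⁺b⁺, a⁻b⁻) = (ab)⁺`. [folklore] -/
theorem max_posPart_mul_posPart (a b : ℝ) :
    max (max a 0 * max b 0) (max (-a) 0 * max (-b) 0) = max (a * b) 0 := by
  rcases le_total 0 a with ha | ha <;> rcases le_total 0 b with hb | hb
  · rw [max_eq_left ha, max_eq_left hb, max_eq_right (neg_nonpos.2 ha), zero_mul,
      max_eq_left (mul_nonneg ha hb)]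
  · rw [max_eq_left ha, max_eq_right hb, mul_zero, max_eq_right (neg_nonpos.2 ha), zero_mul,
      max_self, max_eq_right (mul_nonpos_of_nonneg_of_nonpos ha hb)]
  · rw [max_eq_right ha, zero_mul, max_eq_right (neg_nonpos.2 hb), mul_zero, max_self,
      max_eq_right (mul_nonpos_of_nonpos_of_nonneg ha hb)]
  · rw [max_eq_right ha, zero_mul, max_eq_left (neg_nonneg.2 ha), max_eq_left (neg_nonneg.2 hb),
      neg_mul_neg, max_eq_right (mul_nonneg_of_nonpos_of_nonpos ha hb),
      max_eq_left (mul_nonneg_of_nonpos_of_nonpos ha hb)]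

/-- The coercion of a `⊔` in the unit interval is the `max` of the coercions; this is Mathlib's
`Set.Icc.coe_sup`, kept under its old name as a deprecated alias (dedup-00791). [folklore] -/
@[deprecated Set.Icc.coe_sup (since := "2026-08-15")]
theorem unitInterval.coe_sup (a b : unitInterval) :
    ((a ⊔ b : unitInterval) : ℝ) = max (a : ℝ) b :=
  Set.Icc.coe_sup

/-- **The two-sided Lupu weight** of an edge `{u, v}` of `ℤ^d`: `1 - exp(-2 (ψ_u ψ_v)⁺)` — the
probability, given the discrete field `ψ = φ + h` at the endpoints, that the cable-system field
`φ̃ + h` has no zero on the cable (Brownian-bridge reflection), i.e. that the cable lies in ONE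
sign cluster of `φ̃ + h`; it is the maximum of the one-sided weights of `ψ` and `-ψ` (at most one of
which is non-zero). (Lupu 2016, Cor. 3.6 / (4.2).) [cite: Lupu2016, Cor. 3.6 (arXiv numbering)] -/
theorem coe_sup_lupuWeight_of_adj (ψ : Site d → ℝ) {u v : Site d} (h : (zdGraph d).Adj u v) :
    ((lupuWeight ψ ⊔ lupuWeight (-ψ)) s(u, v) : ℝ) = 1 - Real.exp (-2 * max (ψ u * ψ v) 0) := by
  rw [Pi.sup_apply, Set.Icc.coe_sup, coe_lupuWeight_of_adj ψ h, coe_lupuWeight_of_adj (-ψ) h,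
    Pi.neg_apply, Pi.neg_apply, ← max_posPart_mul_posPart]
  have hmono : Monotone fun s : ℝ => 1 - Real.exp (-2 * s) := fun s t hst => by
    have := Real.exp_le_exp.2 (show -2 * t ≤ -2 * s by linarith)
    linarith
  exact (hmono.map_max).symm

/-- Off the edges of `ℤ^d` the two-sided weight vanishes. [cite: Lupu2016, Cor. 3.6 (arXiv numbering)] -/
theorem sup_lupuWeight_of_not_mem (ψ : Site d → ℝ) {e : Sym2 (Site d)} (he : e ∉ (zdGraph d).edgeSet) :
    (lupuWeight ψ ⊔ lupuWeight (-ψ)) e = 0 := by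
  rw [Pi.sup_apply, lupuWeight_of_not_mem ψ he, lupuWeight_of_not_mem (-ψ) he, sup_idem]

/-- The two-sided weights are invariant under a global sign change of the field.
[cite: Lupu2016, Cor. 3.6 (arXiv numbering)] -/
theorem sup_lupuWeight_neg (ψ : Site d → ℝ) :
    lupuWeight (-ψ) ⊔ lupuWeight (- -ψ) = lupuWeight ψ ⊔ lupuWeight (-ψ) := by
  rw [neg_neg, sup_comm]

/-- The two-sided weight of an edge depends only on the product of the field values at its
endpoints. [cite: Lupu2016, Cor. 3.6 (arXiv numbering)] -/
theorem sup_lupuWeight_congr {ψ ψ' : Site d → ℝ} {u v : Site d} (h : ψ u * ψ v = ψ' u * ψ' v) :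
    (lupuWeight ψ ⊔ lupuWeight (-ψ)) s(u, v) = (lupuWeight ψ' ⊔ lupuWeight (-ψ')) s(u, v) := by
  by_cases hadj : (zdGraph d).Adj u v
  · apply Subtype.ext
    rw [coe_sup_lupuWeight_of_adj ψ hadj, coe_sup_lupuWeight_of_adj ψ' hadj, h]
  · have he : s(u, v) ∉ (zdGraph d).edgeSet := fun he => hadj ((SimpleGraph.mem_edgeSet _).1 he)
    rw [sup_lupuWeight_of_not_mem ψ he, sup_lupuWeight_of_not_mem ψ' he]

/-- Flipping the sign of the field on `K` does not change the two-sided weights of the edges with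
both endpoints in `K`. [cite: Lupu2016, Cor. 3.6 (arXiv numbering)] -/
theorem sup_lupuWeight_flip_eq (ψ : Site d → ℝ) (K : Finset (Site d)) {e : Sym2 (Site d)}
    (he : ∀ z ∈ e, z ∈ K) :
    (lupuWeight (fun y => if y ∈ K then -ψ y else ψ y) ⊔
        lupuWeight (-fun y => if y ∈ K then -ψ y else ψ y)) e =
      (lupuWeight ψ ⊔ lupuWeight (-ψ)) e := by
  induction e using Sym2.ind with
  | _ u v =>
    refine sup_lupuWeight_congr ?_
    rw [if_pos (he u (Sym2.mem_mk_left u v)), if_pos (he v (Sym2.mem_mk_right u v))]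
    ring

/-- On an edge with both endpoints where the field is positive, the one- and two-sided weights
agree. [cite: Lupu2016, Cor. 3.6 (arXiv numbering)] -/
theorem sup_lupuWeight_eq_of_pos (ψ : Site d → ℝ) {u v : Site d} (hu : 0 < ψ u) :
    (lupuWeight ψ ⊔ lupuWeight (-ψ)) s(u, v) = lupuWeight ψ s(u, v) := by
  rw [Pi.sup_apply, lupuWeight_eq_zero_of_nonpos (-ψ) (show (-ψ) u ≤ 0 by simp [hu.le]) v]
  exact sup_eq_left.2 (Subtype.coe_le_coe.1 (lupuWeight ψ s(u, v)).2.1)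

/-- An edge from a positive site to a non-positive site is closed in both models.
[cite: Lupu2016, Cor. 3.6 (arXiv numbering)] -/
theorem lupuWeight_eq_zero_of_pos_of_nonpos (ψ : Site d → ℝ) {u v : Site d} (hv : ψ v ≤ 0) :
    lupuWeight ψ s(u, v) = 0 := by
  rw [Sym2.eq_swap]
  exact lupuWeight_eq_zero_of_nonpos ψ hv u

/-- An edge from a positive site to a non-positive site has two-sided weight `0`.
[cite: Lupu2016, Cor. 3.6 (arXiv numbering)] -/
theorem sup_lupuWeight_eq_zero_of_pos_of_nonpos (ψ : Site d → ℝ) {u v : Site d} (hu : 0 < ψ u)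
    (hv : ψ v ≤ 0) : (lupuWeight ψ ⊔ lupuWeight (-ψ)) s(u, v) = 0 := by
  rw [sup_lupuWeight_eq_of_pos ψ hu, lupuWeight_eq_zero_of_pos_of_nonpos ψ hv]

/-! ### Measurability of the quenched probabilities -/

/-- `ψ ↦ lupuWeight ψ` is measurable (each weight is a continuous function of two coordinates).
[folklore] -/
theorem measurable_lupuWeight : Measurable fun ψ : Site d → ℝ => lupuWeight ψ := by
  refine measurable_pi_lambda _ fun e => ?_
  induction e using Sym2.ind with
  | _ u v =>
    by_cases hadj : (zdGraph d).Adj u v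
    · have hmem : s(u, v) ∈ (zdGraph d).edgeSet := (SimpleGraph.mem_edgeSet _).2 hadj
      have : (fun ψ : Site d → ℝ => lupuWeight ψ s(u, v)) = fun ψ =>
          Set.projIcc (0 : ℝ) 1 zero_le_one (1 - Real.exp (-2 * (max (ψ u) 0 * max (ψ v) 0))) := by
        funext ψ
        simp only [lupuWeight, hmem, if_true, Sym2.map_mk, Sym2.mul_mk]
      rw [this]
      refine continuous_projIcc.measurable.comp ?_
      fun_prop
    · have hmem : s(u, v) ∉ (zdGraph d).edgeSet := fun h => hadj ((SimpleGraph.mem_edgeSet _).1 h)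
      have : (fun ψ : Site d → ℝ => lupuWeight ψ s(u, v)) = fun _ => 0 := by
        funext ψ; exact lupuWeight_of_not_mem ψ hmem
      rw [this]
      exact measurable_const

/-- `ψ ↦ lupuWeight ψ ⊔ lupuWeight (-ψ)` is measurable. [folklore] -/
theorem measurable_sup_lupuWeight :
    Measurable fun ψ : Site d → ℝ => lupuWeight ψ ⊔ lupuWeight (-ψ) := by
  refine measurable_pi_lambda _ fun e => ?_
  have h1 : Measurable fun ψ : Site d → ℝ => lupuWeight ψ e :=
    (measurable_pi_apply e).comp measurable_lupuWeight
  have h2 : Measurable fun ψ : Site d → ℝ => lupuWeight (-ψ) e :=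
    (measurable_pi_apply e).comp (measurable_lupuWeight.comp measurable_neg)
  exact h1.sup h2

/-- For every measurable event `A`, the quenched probabilities `ψ ↦ P_{lupuWeight ψ}(A)` and
`ψ ↦ P_{lupuWeight ψ ⊔ lupuWeight (-ψ)}(A)` are measurable functions of the field. [folklore] -/
theorem measurable_prodBernoulli_lupuWeight_real {A : Set (BondConfig (Site d))}
    (hA : MeasurableSet A) :
    Measurable (fun ψ : Site d → ℝ => (prodBernoulli (lupuWeight ψ)).real A) ∧
      Measurable (fun ψ : Site d → ℝ => (prodBernoulli (lupuWeight ψ ⊔ lupuWeight (-ψ))).real A) := by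
  constructor
  · exact ((measurable_prodBernoulli_apply hA).comp measurable_lupuWeight).ennreal_toReal
  · exact ((measurable_prodBernoulli_apply hA).comp measurable_sup_lupuWeight).ennreal_toReal

/-! ### Step A: a positive site percolates in the two-sided model iff in the one-sided model -/

/-- From a site where `ψ > 0`, the percolation probabilities of the one-sided and the two-sided
models agree: the cluster of a positive site only uses edges between positive sites, where the
weights agree, and no edge from a positive to a non-positive site is ever open in either model.
[cite: Lupu2016, Cor. 3.6 (arXiv numbering)] -/
theorem prodBernoulli_sup_lupuWeight_real_percolatesAt_eq_of_pos (ψ : Site d → ℝ) {x : Site d}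
    (hx : 0 < ψ x) :
    (prodBernoulli (lupuWeight ψ ⊔ lupuWeight (-ψ))).real (percolatesAt x) =
      (prodBernoulli (lupuWeight ψ)).real (percolatesAt x) := by
  refine prodBernoulli_real_percolatesAt_eq_of_eqOn _ _ (S := {v | 0 < ψ v}) hx ?_ ?_ ?_
  · intro e he
    induction e using Sym2.ind with
    | _ u v => exact sup_lupuWeight_eq_of_pos ψ (he u (Sym2.mem_mk_left u v))
  · intro u hu v hv
    exact sup_lupuWeight_eq_zero_of_pos_of_nonpos ψ hu (not_lt.1 hv)
  · intro u _ v hv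
    exact lupuWeight_eq_zero_of_pos_of_nonpos ψ (not_lt.1 hv)

/-- From a site where `ψ ≤ 0` the one-sided model does not percolate (all edges at `x` are
closed). [cite: Lupu2016, Cor. 3.6 (arXiv numbering)] -/
theorem prodBernoulli_lupuWeight_real_percolatesAt_eq_zero_of_nonpos (ψ : Site d → ℝ) {x : Site d}
    (hx : ψ x ≤ 0) : (prodBernoulli (lupuWeight ψ)).real (percolatesAt x) = 0 := by
  rw [measureReal_def, prodBernoulli_percolatesAt_eq_zero_of_forall _ (fun v =>
    lupuWeight_eq_zero_of_nonpos ψ hx v), ENNReal.toReal_zero]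

/-- **Step A of the proof**: pointwise in the field,
`ψ_x · θ²(ψ) ≤ ψ_x⁺ · θ¹(ψ)`, where `θ¹, θ²` are the one- and two-sided quenched percolation
probabilities of `x`. [cite: Lupu2016, Cor. 3.6 (arXiv numbering)] -/
theorem mul_real_percolatesAt_sup_le (ψ : Site d → ℝ) (x : Site d) :
    ψ x * (prodBernoulli (lupuWeight ψ ⊔ lupuWeight (-ψ))).real (percolatesAt x) ≤
      max (ψ x) 0 * (prodBernoulli (lupuWeight ψ)).real (percolatesAt x) := by
  rcases lt_or_ge 0 (ψ x) with hx | hx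
  · rw [prodBernoulli_sup_lupuWeight_real_percolatesAt_eq_of_pos ψ hx, max_eq_left hx.le]
  · rw [max_eq_right hx, zero_mul]
    exact mul_nonpos_of_nonpos_of_nonneg hx measureReal_nonneg

end Literature.Probability.LatticeModels

end
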